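import Literature.NumberTheory.NumberFields.RayClassFieldOfCharacter
import Literature.NumberTheory.GaloisRepresentations.RayClassGroupFinite
import HarnessLib

/-!
# The ray class field `mod 𝔪` as a compositum of class fields of characters: unramified off `𝔪`,
# and a prime that splits completely lies in the ray

Topic `NumberTheory/NumberFields` (class field theory).  Definitions with bodies (the classes
`[𝔭] ∈ Cl_K^𝔪` and auxiliary maps) and theorems, all proved, no named fact; unconditional; the modulus-`𝔪` companion of
`HilbertClassFieldOfCharacters.lean` (`exists_hilbertClassField_data`, the case `𝔪 = 1`) built on the
same PROVED inputs of the tree: the class field of a ray class character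
(`RayClassFieldOfCharacter.lean`, re-run here to record the splitting law in BOTH directions), the ray
class group `Cl_K^𝔪 = J^𝔪/P^𝔪` and its finiteness (`GaloisRepresentations/RayClassGroup.lean`,
`RayClassGroupFinite.lean`).

> Neukirch, *Algebraic Number Theory*, VI (6.2)–(6.3), (7.1), (7.3): the ray class field `K^𝔪|K`
> has Galois group `Cl_K^𝔪`, is unramified outside `𝔪`, and "`𝔭` splits completely in `L ⟺ 𝔭 ∈ H^𝔪`";
> for `L = K^𝔪`, `H^𝔪 = P^𝔪`: a prime `𝔭 ∤ 𝔪` splits completely iff `𝔭 = (a)` with `a ≡ 1 mod 𝔪`,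
> `a` totally positive.  Cox, *Primes of the form x² + ny²*, §8.A Thm. 8.2, 8.6 and (for the ring
> class fields of orders in imaginary quadratic fields, which lie inside `K^{(f)}`) §9.A.

Main results (`K : Type` a number field, `𝔪 ≠ 0` an ideal of `𝓞 K`):

* `primeClass 𝔪 v ∈ Cl_K^𝔪` (the class of `𝔭 ∤ 𝔪`, `1` at `𝔭 ∣ 𝔪`), `artinHom_primeClass_eq_mk`
  (its Artin homomorphism is the quotient map on `J^𝔪`), `artinKillsRay_primeClass`, and
  `isRayClassCharacter_primeClass` — `𝔭 ↦ χ([𝔭])` is a ray class character `mod 𝔪` for every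
  character `χ` of `Cl_K^𝔪`.
* `exists_classField_character_of_isRayClassCharacter` — the class field `E` of a ray class
  character `ψ mod 𝔣` together with an INJECTIVE character `χ` of the (abelian) `Gal(E/K)` such that
  `ψ(v) = χ(Frob_v)` for `v ∤ 𝔣`; `exists_classField_of_isRayClassCharacter'` — consequently the
  splitting law in both directions (`ψ(v) = 1 ⟺ v` splits completely, `v ∤ 𝔪`).
* `exists_rayClassField_data` — **a finite Galois `R ⊆ K̄` over `K`, unramified at every `v ∤ 𝔪`,
  such that every prime `v ∤ 𝔪` that splits completely in `R` lies in the ray**: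
  `RayClassRel 𝔪 ⊤ v`, i.e. `(c)·𝔭 = (b)` with `c` prime to `𝔪`, `b ≡ c mod 𝔪`, `b/c ≫ 0`;
  `exists_rayClassField_data_principal` — consequently `𝔭 = (a)` with `a - 1 ∈ 𝔪`.

## References

* J. Neukirch, *Algebraic Number Theory* (1999), Ch. VI §1 (1.7)–(1.9), §6 (6.2)–(6.3), §7 (7.1),
  (7.3). [NeukirchANT1999]
* D. A. Cox, *Primes of the form x² + ny²*, 2nd ed. (2013), §8.A Thm. 8.2, Thm. 8.6; §9.A. [Cox2013]
-/

noncomputable section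

open NumberField IsDedekindDomain IsDedekindDomain.HeightOneSpectrum Filter Field
open scoped nonZeroDivisors

namespace Literature.NumberTheory.NumberFields

open Literature.NumberTheory.GaloisRepresentations Literature.NumberTheory.Automorphic
  Literature.NumberTheory.LFunctions

variable {K : Type} [Field K] [NumberField K] {𝔪 : Ideal (𝓞 K)}

/-! ### Nonzero integral ideals prime to `𝔪` as elements of `J^𝔪` -/

section Units

variable (𝔪) in
/-- The element of `J^𝔪` given by a nonzero integral ideal prime to `𝔪`. [folklore] -/
def unitOfCoprime (h𝔪 : 𝔪 ≠ ⊥) (I : Ideal (𝓞 K)) (hI : I ≠ ⊥) (hcop : IsCoprime I 𝔪) :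
    idealsPrimeTo 𝔪 :=
  ⟨Units.mk0 (I : FractionalIdeal (𝓞 K)⁰ K) (coeIdeal_ne_zero_of_ne_bot hI),
    unitsMk0_coeIdeal_mem_idealsPrimeTo h𝔪 hI hcop⟩

/-- Unfolding lemma. [folklore] -/
theorem coe_unitOfCoprime (h𝔪 : 𝔪 ≠ ⊥) (I : Ideal (𝓞 K)) (hI : I ≠ ⊥) (hcop : IsCoprime I 𝔪) :
    (((unitOfCoprime 𝔪 h𝔪 I hI hcop : idealsPrimeTo 𝔪) : (FractionalIdeal (𝓞 K)⁰ K)ˣ) :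
      FractionalIdeal (𝓞 K)⁰ K) = I := rfl

/-- A prime not dividing `𝔪 ≠ 0` is prime to `𝔪`. [folklore] -/
theorem isCoprime_asIdeal_of_not_le (h𝔪 : 𝔪 ≠ ⊥) {v : HeightOneSpectrum (𝓞 K)}
    (hv : ¬ 𝔪 ≤ v.asIdeal) : IsCoprime v.asIdeal 𝔪 := by
  refine (isCoprime_iff_forall_not_le h𝔪).mpr fun w hw hle => hv ?_
  have : v.asIdeal = w.asIdeal := v.isMaximal.eq_of_le w.isPrime.ne_top hle
  rwa [this]

variable (𝔪) in
open scoped Classical in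
/-- The element of `J^𝔪` given by a prime `v ∤ 𝔪`, and `1` for `v ∣ 𝔪`. [folklore] -/
def unitOfPrime (h𝔪 : 𝔪 ≠ ⊥) (v : HeightOneSpectrum (𝓞 K)) : idealsPrimeTo 𝔪 :=
  if hv : 𝔪 ≤ v.asIdeal then 1
  else unitOfCoprime 𝔪 h𝔪 v.asIdeal v.ne_bot (isCoprime_asIdeal_of_not_le h𝔪 hv)

/-- For `v ∤ 𝔪`, `unitOfPrime` is the fractional ideal `𝔭_v`. [folklore] -/
theorem unitOfPrime_of_not_le (h𝔪 : 𝔪 ≠ ⊥) {v : HeightOneSpectrum (𝓞 K)} (hv : ¬ 𝔪 ≤ v.asIdeal) :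
    unitOfPrime 𝔪 h𝔪 v = unitOfCoprime 𝔪 h𝔪 v.asIdeal v.ne_bot (isCoprime_asIdeal_of_not_le h𝔪 hv) := by
  classical
  rw [unitOfPrime, dif_neg hv]

/-- For `v ∣ 𝔪`, `unitOfPrime` is `1`. [folklore] -/
theorem unitOfPrime_of_le (h𝔪 : 𝔪 ≠ ⊥) {v : HeightOneSpectrum (𝓞 K)} (hv : 𝔪 ≤ v.asIdeal) :
    unitOfPrime 𝔪 h𝔪 v = 1 := by
  classical
  rw [unitOfPrime, dif_pos hv]

/-- The underlying fractional ideal of `unitOfPrime` at `v ∤ 𝔪`. [folklore] -/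
theorem coe_unitOfPrime_of_not_le (h𝔪 : 𝔪 ≠ ⊥) {v : HeightOneSpectrum (𝓞 K)} (hv : ¬ 𝔪 ≤ v.asIdeal) :
    (((unitOfPrime 𝔪 h𝔪 v : idealsPrimeTo 𝔪) : (FractionalIdeal (𝓞 K)⁰ K)ˣ) :
      FractionalIdeal (𝓞 K)⁰ K) = v.asIdeal := by
  rw [unitOfPrime_of_not_le h𝔪 hv]; rfl

variable (𝔪) in
/-- **The class `[𝔭] ∈ Cl_K^𝔪` of a prime `𝔭 ∤ 𝔪`** (and `1` for `𝔭 ∣ 𝔪`). [cite: NeukirchANT1999, Ch. VI §1 Def. (1.7)] -/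
def primeClass (h𝔪 : 𝔪 ≠ ⊥) (v : HeightOneSpectrum (𝓞 K)) : RayClassGroup 𝔪 :=
  QuotientGroup.mk (unitOfPrime 𝔪 h𝔪 v)

/-- Unfolding lemma. [folklore] -/
theorem primeClass_eq (h𝔪 : 𝔪 ≠ ⊥) (v : HeightOneSpectrum (𝓞 K)) :
    primeClass 𝔪 h𝔪 v = QuotientGroup.mk (unitOfPrime 𝔪 h𝔪 v) := rfl

end Units

/-! ### The Artin homomorphism of `𝔭 ↦ [𝔭]` is the quotient map `J^𝔪 → Cl^𝔪` -/

section Artin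

/-- The factorisation of an invertible fractional ideal as a finite product over the primes in its
support, at the level of units. [folklore] -/
theorem units_eq_prod_zpow (I : (FractionalIdeal (𝓞 K)⁰ K)ˣ) {s : Finset (HeightOneSpectrum (𝓞 K))}
    (hs : ∀ v, FractionalIdeal.count K v (I : FractionalIdeal (𝓞 K)⁰ K) ≠ 0 → v ∈ s) :
    (I : FractionalIdeal (𝓞 K)⁰ K) =
      ∏ v ∈ s, ((v.asIdeal : FractionalIdeal (𝓞 K)⁰ K)) ^
        FractionalIdeal.count K v (I : FractionalIdeal (𝓞 K)⁰ K) := by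
  conv_lhs => rw [← FractionalIdeal.finprod_heightOneSpectrum_factorization' (K := K) (Units.ne_zero I)]
  refine finprod_eq_prod_of_mulSupport_subset _ fun v hv => ?_
  rw [Function.mem_mulSupport] at hv
  rw [Finset.mem_coe]
  refine hs v fun h0 => hv ?_
  rw [h0, zpow_zero]

/-- **The Artin homomorphism of `𝔭 ↦ [𝔭] ∈ Cl_K^𝔪` is the quotient map on `J^𝔪`**:
`∏_𝔭 [𝔭]^{ν_𝔭(I)} = [I]` for `I` prime to `𝔪`. [cite: NeukirchANT1999, Ch. VI §7 Thm. (7.1)] -/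
theorem artinHom_primeClass_eq_mk (h𝔪 : 𝔪 ≠ ⊥) (I : (FractionalIdeal (𝓞 K)⁰ K)ˣ)
    (hI : I ∈ idealsPrimeTo 𝔪) :
    artinHom (primeClass 𝔪 h𝔪) I = QuotientGroup.mk (⟨I, hI⟩ : idealsPrimeTo 𝔪) := by
  classical
  -- the finite support of `I`
  have hfin : {v : HeightOneSpectrum (𝓞 K) |
      FractionalIdeal.count K v (I : FractionalIdeal (𝓞 K)⁰ K) ≠ 0}.Finite := by
    have h := FractionalIdeal.finite_factors (K := K) (I : FractionalIdeal (𝓞 K)⁰ K)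
    rw [Filter.eventually_cofinite] at h
    exact h
  set s := hfin.toFinset with hsdef
  have hs : ∀ v, FractionalIdeal.count K v (I : FractionalIdeal (𝓞 K)⁰ K) ≠ 0 → v ∈ s :=
    fun v hv => hfin.mem_toFinset.mpr hv
  have hsnot : ∀ v ∈ s, ¬ 𝔪 ≤ v.asIdeal := fun v hv hle =>
    (hfin.mem_toFinset.mp hv) (hI v hle)
  -- the element `∏ U_v^{ν_v} ∈ J^𝔪` equals `I`
  set c : HeightOneSpectrum (𝓞 K) → ℤ := fun v =>
    FractionalIdeal.count K v (I : FractionalIdeal (𝓞 K)⁰ K) with hcdef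
  have hprod : (⟨I, hI⟩ : idealsPrimeTo 𝔪) = ∏ v ∈ s, unitOfPrime 𝔪 h𝔪 v ^ c v := by
    apply Subtype.ext
    rw [Subgroup.val_finsetProd]
    apply Units.ext
    simp only [Subgroup.coe_zpow]
    rw [Units.coe_prod, units_eq_prod_zpow I hs]
    refine Finset.prod_congr rfl fun v hv => ?_
    rw [Units.val_zpow_eq_zpow_val, coe_unitOfPrime_of_not_le h𝔪 (hsnot v hv)]
  -- the Artin homomorphism, as a finite product
  have hartin : artinHom (primeClass 𝔪 h𝔪) I = ∏ v ∈ s, primeClass 𝔪 h𝔪 v ^ c v := by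
    rw [artinHom_apply]
    refine finprod_eq_prod_of_mulSupport_subset _ fun v hv => ?_
    rw [Function.mem_mulSupport] at hv
    rw [Finset.mem_coe]
    refine hs v fun h0 => hv ?_
    show primeClass 𝔪 h𝔪 v ^ c v = 1
    rw [hcdef]
    simp only
    rw [h0, zpow_zero]
  rw [hartin, hprod, QuotientGroup.mk_prod]
  refine Finset.prod_congr rfl fun v _ => ?_
  rw [QuotientGroup.mk_zpow, primeClass_eq]

/-- **The Artin homomorphism of `𝔭 ↦ [𝔭]` kills the ray** `P^𝔪` (`[(b)] = [(c)]` for `b ≡ c mod 𝔪`,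
`c` prime to `𝔪`, `b/c ≫ 0`). [cite: NeukirchANT1999, Ch. VI §7 Thm. (7.1)] -/
theorem artinKillsRay_primeClass (h𝔪 : 𝔪 ≠ ⊥) :
    LFunctions.AbelianDensity.ArtinKillsRay 𝔪 (primeClass 𝔪 h𝔪) := by
  rw [artinKillsRay_iff_ray_le_ker h𝔪]
  intro I hIray
  have hI : I ∈ idealsPrimeTo 𝔪 := ray_le_idealsPrimeTo h𝔪 hIray
  rw [MonoidHom.mem_ker, artinHom_primeClass_eq_mk h𝔪 I hI, QuotientGroup.eq_one_iff,
    Subgroup.mem_subgroupOf]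
  exact hIray

/-- **`𝔭 ↦ χ([𝔭])` is a ray class character `mod 𝔪`** for every homomorphism `χ : Cl_K^𝔪 → ℂˣ`
(granted the finiteness of `Cl_K^𝔪`, for the norm-one condition). [cite: NeukirchANT1999, Ch. VII §6 Def. (6.8)] -/
theorem isRayClassCharacter_primeClass [Finite (RayClassGroup 𝔪)] (h𝔪 : 𝔪 ≠ ⊥)
    (χ : RayClassGroup 𝔪 →* ℂˣ) :
    IsRayClassCharacter 𝔪 (fun v => (χ (primeClass 𝔪 h𝔪 v) : ℂ)) := by
  classical
  refine ⟨fun v _ => ?_, fun b c hb hc hcop hbc hpos => ?_⟩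
  · haveI : Fintype (RayClassGroup 𝔪) := Fintype.ofFinite _
    have hpow : (χ (primeClass 𝔪 h𝔪 v) : ℂ) ^ Fintype.card (RayClassGroup 𝔪) = 1 := by
      rw [← Units.val_pow_eq_pow_val, ← map_pow, pow_card_eq_one, map_one, Units.val_one]
    exact Complex.norm_eq_one_of_pow_eq_one hpow Fintype.card_ne_zero
  · have hb' : Ideal.span {b} ≠ ⊥ := by simpa [Ideal.span_singleton_eq_bot] using hb
    have hc' : Ideal.span {c} ≠ ⊥ := by simpa [Ideal.span_singleton_eq_bot] using hc
    have key := artinKillsRay_primeClass h𝔪 b c hb hc hcop hbc hpos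
    have e : (fun v => (χ (primeClass 𝔪 h𝔪 v) : ℂ)) =
        fun v => ((Units.coeHom ℂ).comp χ) (primeClass 𝔪 h𝔪 v) := rfl
    rw [e, LFunctions.AbelianDensity.idealPow_comp_eq ((Units.coeHom ℂ).comp χ) (primeClass 𝔪 h𝔪) hb',
      LFunctions.AbelianDensity.idealPow_comp_eq ((Units.coeHom ℂ).comp χ) (primeClass 𝔪 h𝔪) hc', key]

end Artin

/-! ### Frobenius decides splitting -/

section Frobenius

/-- `v` splits completely in the finite Galois `E/K` iff `Frob_v = 1`, for `v` unramified in `E`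
(the tree's `mem_splitPrimes_iff_galFrob_eq_one` of `ClassFieldsOfCharactersUniqueness.lean`, repeated
to keep this file's imports inside class field theory). [cite: Marcus2018, Ch. 4, Thm. 32 ff.] -/
private theorem splitPrimes_iff_galFrob {E : Type} [Field E] [NumberField E] [Algebra K E]
    [IsGalois K E] {v : HeightOneSpectrum (𝓞 K)} (hunr : Algebra.IsUnramifiedIn (𝓞 E) v.asIdeal) :
    v ∈ splitPrimes K E ↔ galFrob K E v = 1 := by
  obtain ⟨Q, hQ, hφ⟩ := galFrob_spec K E v
  haveI : IsGalois K (⊤ : IntermediateField K E) := IsGalois.of_algEquiv IntermediateField.topEquiv.symm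
  haveI : NumberField (⊤ : IntermediateField K E) := NumberField.of_module_finite K _
  have hunr' : Algebra.IsUnramifiedIn (𝓞 (⊤ : IntermediateField K E)) v.asIdeal := by
    haveI := v.isMaximal
    haveI : IsGaloisGroup ((⊤ : IntermediateField K E) ≃ₐ[K] (⊤ : IntermediateField K E)) (𝓞 K)
        (𝓞 (⊤ : IntermediateField K E)) :=
      IsGaloisGroup.of_isFractionRing _ _ _ K (⊤ : IntermediateField K E)
    haveI : IsGaloisGroup (E ≃ₐ[K] E) (𝓞 K) (𝓞 E) := IsGaloisGroup.of_isFractionRing _ _ _ K E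
    exact isUnramifiedIn_of_algEquiv
      (RingOfIntegers.mapAlgEquiv (IntermediateField.topEquiv (F := K) (E := E))) v.ne_bot hunr
  have key := mem_splitPrimes_intermediateField_iff (⊤ : IntermediateField K E) hunr hunr' hQ hφ
  rw [IntermediateField.fixingSubgroup_top, Subgroup.mem_bot] at key
  rw [← key, Literature.NumberTheory.EllipticCurves.splitPrimes_eq_of_algEquiv
    (IntermediateField.topEquiv (F := K) (E := E))]

end Frobenius

/-! ### The class field of a ray class character, splitting law in both directions -/

section ClassField

/-- **The class field of a ray class character, together with its character.**  For `𝔣 ≠ 0`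
and a ray class character `ψ mod 𝔣` there is a finite ABELIAN Galois `E ⊆ K̄` over `K`, unramified at
every `v ∤ 𝔣`, and an INJECTIVE character `χ : Gal(E/K) → ℂˣ` with `ψ(v) = χ(φ|_E)` for every
`v ∤ 𝔣` and every arithmetic Frobenius `φ ∈ Γ_K` at a prime of `\bar ℤ_K` above `v` (i.e.
`ψ(v) = χ(Frob_v)`; Neukirch VI (7.1)/(7.3) with Artin reciprocity V (5.1)(A) in character form: `ψ` is the
Hecke character `χ ∘ (E|K / ·)`; the tree's `exists_classField_of_isRayClassCharacter`, re-run to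
export `χ` itself — needed to COUNT `Gal` of a compositum of such class fields, e.g. the ring class
field, `RingClassFieldOfConductor`).
[cite: NeukirchANT1999, Ch. VI §7 Thm. (7.1) and (7.3), §6 Cor. (6.6)] -/
theorem exists_classField_character_of_isRayClassCharacter {𝔣 : Ideal (𝓞 K)} (h𝔣 : 𝔣 ≠ ⊥)
    {ψ : HeightOneSpectrum (𝓞 K) → ℂ} (hray : IsRayClassCharacter 𝔣 ψ) :
    ∃ E : IntermediateField K (AlgebraicClosure K), ∃ (_ : FiniteDimensional K E)
      (_ : IsAbelianGalois K E),
      (∀ v : HeightOneSpectrum (𝓞 K), ¬ 𝔣 ≤ v.asIdeal → Algebra.IsUnramifiedIn (𝓞 E) v.asIdeal) ∧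
      ∃ χ : (E ≃ₐ[K] E) →* ℂˣ, Function.Injective χ ∧
        ∀ v : HeightOneSpectrum (𝓞 K), ¬ 𝔣 ≤ v.asIdeal → ∀ 𝔓 ∈ v.primesAbove,
          ∀ σ : absoluteGaloisGroup K, IsArithFrobAt (𝓞 K) σ 𝔓 →
            ψ v = ((χ (absRestrictNormalHom E σ) : ℂˣ) : ℂ) := by
  classical
  set hR := artinReciprocity_character_holds
  obtain ⟨ω, hωfin, hω⟩ := HeckeCharacter.exists_of_isRayClassCharacter h𝔣 hray
  obtain ⟨L, hLfd, hLab, χ₀, hωχ₀⟩ := HeckeCharacter.exists_eq_charHecke_of_isFiniteOrder ω hωfin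
  haveI := hLfd
  haveI := hLab
  haveI : NumberField L := NumberField.of_module_finite K L
  set ρ : FramedArtinRep K 1 := inflateCharacter L χ₀ with hρdef
  obtain ⟨E, hEfd, hEab, χ, hχρ, hχinj⟩ := exists_inflateCharacter_eq_injective ρ
  haveI := hEfd
  haveI := hEab
  haveI : NumberField E := NumberField.of_module_finite K E
  have hcommE : ∀ a b : E ≃ₐ[K] E, Commute a b := commute_of_isAbelianGalois E
  have hωχ : ω = charHecke E χ hR := by
    rw [hωχ₀]
    show heckeOfArtinCharacter hR (inflateCharacter L χ₀) = heckeOfArtinCharacter hR (inflateCharacter E χ)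
    rw [hχρ]
  have hρunr : ∀ v : HeightOneSpectrum (𝓞 K), ω.IsUnramifiedAt v → ρ.IsUnramifiedAt v := by
    obtain ⟨ω', -, hω'⟩ := artinReciprocity_character_primitive_holds (K := K) ρ
    have heq : ω' = ω := by
      apply HeckeCharacter.ext_of_eventually_valueAtUniformizer_eq
      have hunrE : ∀ᶠ v : HeightOneSpectrum (𝓞 K) in cofinite,
          Algebra.IsUnramifiedIn (𝓞 E) v.asIdeal :=
        Filter.eventually_cofinite.mpr (finite_setOf_not_isUnramifiedIn K E)
      filter_upwards [hunrE] with v hunr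
      have hρv : ρ.IsUnramifiedAt v := by
        rw [← hχρ]
        exact inflateCharacter_isUnramifiedAt E χ hunr
      obtain ⟨𝔓v, h𝔓v⟩ := v.primesAbove_nonempty
      obtain ⟨σ, hσ⟩ := HeightOneSpectrum.exists_isArithFrobAt_of_mem_primesAbove_holds h𝔓v
      rw [(hω' v).2 hρv 𝔓v h𝔓v σ hσ, hωχ, charHecke_valueAtUniformizer E χ hR hunr]
      haveI : 𝔓v.IsPrime := h𝔓v.1
      have hP := comap_ringOfIntegersToIntegralClosure_mem_primesOver_of_mem_primesAbove E h𝔓v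
      have hrσ := isArithFrobAt_absRestrictNormalHom E hσ
      have hfrob : absRestrictNormalHom E σ = galFrob K E v := eq_galFrob hcommE hunr hP hrσ
      rw [FramedRep.det_apply, Matrix.GeneralLinearGroup.val_det_apply, Matrix.det_fin_one, ← hχρ,
        inflateCharacter_apply_coe, hfrob]
    intro v hv
    have h := (hω' v).1
    rw [heq] at h
    exact h.mp hv
  have hunrE : ∀ v : HeightOneSpectrum (𝓞 K), ¬ 𝔣 ≤ v.asIdeal →
      Algebra.IsUnramifiedIn (𝓞 E) v.asIdeal := by
    intro v hv
    by_contra hram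
    obtain ⟨𝔓, h𝔓, g, hg, hne⟩ := exists_mem_inertia_absRestrictNormalHom_ne_one (L := E) hram
    apply hne
    have h1 : ρ g = 1 := hρunr v (hω v hv).1 𝔓 h𝔓 g hg
    rw [← hχρ, inflateCharacter_apply] at h1
    have h2 : χ (absRestrictNormalHom E g) = 1 :=
      (FramedRep.unitsContinuousMulEquivOfUnique (Fin 1) ℂ).injective (by rw [h1, map_one])
    exact hχinj (by rw [h2, map_one])
  have hval : ∀ v : HeightOneSpectrum (𝓞 K), ¬ 𝔣 ≤ v.asIdeal →
      ψ v = ((χ (galFrob K E v) : ℂˣ) : ℂ) := by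
    intro v hv
    rw [← (hω v hv).2, hωχ, charHecke_valueAtUniformizer E χ hR (hunrE v hv)]
  refine ⟨E, inferInstance, inferInstance, hunrE, χ, hχinj, fun v hv 𝔓 h𝔓 σ hσ => ?_⟩
  haveI : 𝔓.IsPrime := h𝔓.1
  have hP := comap_ringOfIntegersToIntegralClosure_mem_primesOver_of_mem_primesAbove E h𝔓
  have hrσ := isArithFrobAt_absRestrictNormalHom E hσ
  rw [hval v hv, eq_galFrob hcommE (hunrE v hv) hP hrσ]

/-- **The class field of a ray class character, with the full splitting law.**  For `𝔣 ≠ 0` and a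
ray class character `ψ mod 𝔣` there is a finite Galois (abelian) `E ⊆ K̄` over `K` with:
(i) `E` unramified at every `v ∤ 𝔣`; (ii)/(ii') for `v ∤ 𝔣`, `ψ(v) = 1 ⟺ v` splits completely in `E`
(Neukirch VI (7.3)); (iii) if `ψ^N = 1` off `𝔣` then `Gal(E/K)` has exponent dividing `N`.  The
tree's `exists_classField_of_isRayClassCharacter`, re-run to record (ii') (`ψ(v) = χ(Frob_v)` with `χ`
injective, and `Frob_v = 1 ⟺ v` splits, `mem_splitPrimes_iff_galFrob_eq_one`).
[cite: NeukirchANT1999, Ch. VI §7 Thm. (7.1) and (7.3), §6 Cor. (6.6)] -/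
theorem exists_classField_of_isRayClassCharacter' {𝔣 : Ideal (𝓞 K)} (h𝔣 : 𝔣 ≠ ⊥)
    {ψ : HeightOneSpectrum (𝓞 K) → ℂ} (hray : IsRayClassCharacter 𝔣 ψ) :
    ∃ E : IntermediateField K (AlgebraicClosure K), FiniteDimensional K E ∧ IsGalois K E ∧
      (∀ v : HeightOneSpectrum (𝓞 K), ¬ 𝔣 ≤ v.asIdeal → Algebra.IsUnramifiedIn (𝓞 E) v.asIdeal) ∧
      (∀ v : HeightOneSpectrum (𝓞 K), ¬ 𝔣 ≤ v.asIdeal → ψ v = 1 → v ∈ splitPrimes K E) ∧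
      (∀ v : HeightOneSpectrum (𝓞 K), ¬ 𝔣 ≤ v.asIdeal → v ∈ splitPrimes K E → ψ v = 1) ∧
      (∀ N : ℕ, (∀ v : HeightOneSpectrum (𝓞 K), ¬ 𝔣 ≤ v.asIdeal → ψ v ^ N = 1) →
        ∀ g : E ≃ₐ[K] E, g ^ N = 1) := by
  classical
  obtain ⟨E, hEfd, hEab, hunrE, χ, hχinj, hvalabs⟩ :=
    exists_classField_character_of_isRayClassCharacter h𝔣 hray
  haveI := hEfd
  haveI := hEab
  haveI : NumberField E := NumberField.of_module_finite K E
  have hcommE : ∀ a b : E ≃ₐ[K] E, Commute a b := commute_of_isAbelianGalois E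
  -- `ψ(v) = χ(Frob_v)`: any arithmetic Frobenius of `Γ_K` above `v` restricts to `Frob_v`
  have hval : ∀ v : HeightOneSpectrum (𝓞 K), ¬ 𝔣 ≤ v.asIdeal →
      ψ v = ((χ (galFrob K E v) : ℂˣ) : ℂ) := by
    intro v hv
    obtain ⟨𝔓, h𝔓⟩ := v.primesAbove_nonempty
    obtain ⟨σ, hσ⟩ := HeightOneSpectrum.exists_isArithFrobAt_of_mem_primesAbove_holds h𝔓
    haveI : 𝔓.IsPrime := h𝔓.1
    have hP := comap_ringOfIntegersToIntegralClosure_mem_primesOver_of_mem_primesAbove E h𝔓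
    have hrσ := isArithFrobAt_absRestrictNormalHom E hσ
    rw [hvalabs v hv 𝔓 h𝔓 σ hσ, eq_galFrob hcommE (hunrE v hv) hP hrσ]
  refine ⟨E, inferInstance, inferInstance, hunrE, ?_, ?_, ?_⟩
  · intro v hv h1
    have hfrob : galFrob K E v = 1 := by
      apply hχinj
      rw [map_one]
      exact Units.val_injective (by rw [← hval v hv, h1, Units.val_one])
    exact (splitPrimes_iff_galFrob (hunrE v hv)).mpr hfrob
  · intro v hv hsplit
    have hfrob : galFrob K E v = 1 := (splitPrimes_iff_galFrob (hunrE v hv)).mp hsplit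
    rw [hval v hv, hfrob, map_one, Units.val_one]
  · intro N hN g
    have hχN : χ ^ N = 1 := by
      refine MonoidHom.eq_one_of_forall_galFrob E (χ ^ N) (finite_setOf_le_asIdeal h𝔣) ?_
      intro v hv _
      rw [Set.mem_setOf_eq] at hv
      rw [MonoidHom.pow_apply]
      apply Units.val_injective
      rw [Units.val_pow_eq_pow_val, ← hval v hv, hN v hv, Units.val_one]
    apply hχinj
    rw [map_pow, ← MonoidHom.pow_apply, hχN, MonoidHom.one_apply, map_one]

end ClassField

/-! ### The ray class field data -/

section RayClassField

/-- **The ray class field `mod 𝔪`, in the form needed for Bauer-type arguments.**  For a number field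
`K` and an ideal `𝔪 ≠ 0` of `𝓞 K` there is a finite Galois `R ⊆ K̄` over `K`, unramified at every
prime `v ∤ 𝔪`, such that every prime `v ∤ 𝔪` of `K` that splits completely in `R` lies in the ray
`mod 𝔪`: `RayClassRel 𝔪 ⊤ 𝔭_v`, i.e. `(c) 𝔭_v = (b)` for nonzero integers `b, c` with `c` prime to
`𝔪`, `b ≡ c mod 𝔪` and `b/c` totally positive.  Construction: `R` is the compositum of the class fields
`E_χ` (`exists_classField_of_isRayClassCharacter'`) of the ray class characters `𝔭 ↦ χ([𝔭])`, `χ`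
ranging over the finitely many characters of `Cl_K^𝔪` (`finite_rayClassGroup`); an inertia element at `v ∤ 𝔪` fixes every
`E_χ`, hence `R`; a prime splitting completely in `R` splits completely in every `E_χ`, so
`χ([𝔭]) = 1` for all `χ`, i.e. `[𝔭] = 1` in `Cl_K^𝔪 = J^𝔪/P^𝔪`.  (Neukirch VI (6.2)–(6.3), (7.3): the
ray class field; here from the tree's PROVED class field theory.)
[cite: NeukirchANT1999, Ch. VI §6 (6.2)–(6.3) and §7 Thm. (7.1), (7.3)] [cite: Cox2013, §8.A Thm. 8.2 and Thm. 8.6] -/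
theorem exists_rayClassField_data (h𝔪 : 𝔪 ≠ ⊥) :
    ∃ R : IntermediateField K (AlgebraicClosure K), FiniteDimensional K R ∧ IsGalois K R ∧
      (∀ v : HeightOneSpectrum (𝓞 K), ¬ 𝔪 ≤ v.asIdeal → Algebra.IsUnramifiedIn (𝓞 R) v.asIdeal) ∧
      ∀ v : HeightOneSpectrum (𝓞 K), ¬ 𝔪 ≤ v.asIdeal → v ∈ splitPrimes K R →
        RayClassRel 𝔪 ⊤ v.asIdeal := by
  classical
  haveI := finite_rayClassGroup (K := K) h𝔪
  -- finitely many characters of `Cl_K^𝔪`; enough roots of unity in `ℂ`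
  haveI : NeZero ((Monoid.exponent (RayClassGroup 𝔪) : ℕ) : ℂ) :=
    ⟨Nat.cast_ne_zero.mpr (Monoid.exponent_ne_zero.mpr
      (Monoid.ExponentExists.of_finite (G := RayClassGroup 𝔪)))⟩
  haveI : HasEnoughRootsOfUnity ℂ (Monoid.exponent (RayClassGroup 𝔪)) := inferInstance
  have hcard : Nat.card (RayClassGroup 𝔪 →* ℂˣ) = Nat.card (RayClassGroup 𝔪) :=
    CommGroup.card_monoidHom_of_hasEnoughRootsOfUnity (RayClassGroup 𝔪) ℂ
  haveI : Finite (RayClassGroup 𝔪 →* ℂˣ) :=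
    Nat.finite_of_card_ne_zero (by rw [hcard]; exact Nat.card_pos.ne')
  -- the class fields of the characters `𝔭 ↦ χ([𝔭])`
  choose E hE using fun χ : RayClassGroup 𝔪 →* ℂˣ =>
    exists_classField_of_isRayClassCharacter' h𝔪 (isRayClassCharacter_primeClass h𝔪 χ)
  haveI : ∀ χ, FiniteDimensional K (E χ) := fun χ => (hE χ).1
  haveI : ∀ χ, IsGalois K (E χ) := fun χ => (hE χ).2.1
  set R : IntermediateField K (AlgebraicClosure K) := ⨆ χ, E χ with hRdef
  haveI : FiniteDimensional K R := by rw [hRdef]; infer_instance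
  haveI : Normal K R := by rw [hRdef]; infer_instance
  haveI : IsGalois K R := IsGalois.mk
  haveI : NumberField R := NumberField.of_module_finite K R
  -- `R/K` is unramified off `𝔪`
  have hunrR : ∀ v : HeightOneSpectrum (𝓞 K), ¬ 𝔪 ≤ v.asIdeal →
      Algebra.IsUnramifiedIn (𝓞 R) v.asIdeal := by
    intro v hv
    by_contra hram
    obtain ⟨𝔓, h𝔓, g, hg, hne⟩ := exists_mem_inertia_absRestrictNormalHom_ne_one (L := R) hram
    apply hne
    rw [absRestrictNormalHom_eq_one_iff]
    have hfix : ∀ χ, absoluteGaloisGroup.toAlgEquiv K g ∈ (E χ).fixingSubgroup := fun χ => by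
      haveI : NumberField (E χ) := NumberField.of_module_finite K _
      rw [← absRestrictNormalHom_eq_one_iff]
      exact absRestrictNormalHom_eq_one_of_isUnramifiedIn (E χ) ((hE χ).2.2.1 v hv) h𝔓 hg
    have hle : R ≤ IntermediateField.fixedField
        (Subgroup.zpowers (absoluteGaloisGroup.toAlgEquiv K g)) := by
      rw [hRdef]
      refine iSup_le fun χ => ?_
      rw [IntermediateField.le_iff_le, Subgroup.zpowers_le]
      exact hfix χ
    rw [IntermediateField.le_iff_le, Subgroup.zpowers_le] at hle
    exact hle
  refine ⟨R, inferInstance, inferInstance, hunrR, fun v hv hsplit => ?_⟩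
  -- `χ([v]) = 1` for every character, so `[v] = 1`
  have h1 : ∀ χ : RayClassGroup 𝔪 →* ℂˣ, χ (primeClass 𝔪 h𝔪 v) = 1 := fun χ => by
    have hvE : v ∈ splitPrimes K (E χ) :=
      mem_splitPrimes_of_le (by rw [hRdef]; exact le_iSup E χ) ((hE χ).2.2.1 v hv) hsplit
    have := (hE χ).2.2.2.2.1 v hv hvE
    exact Units.val_injective (by rw [Units.val_one]; exact this)
  have h2 : primeClass 𝔪 h𝔪 v = 1 := by
    by_contra hne
    obtain ⟨φ, hφ⟩ := CommGroup.exists_apply_ne_one_of_hasEnoughRootsOfUnity (RayClassGroup 𝔪) ℂ hne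
    exact hφ (h1 φ)
  -- unwind: `𝔭_v = (a)` with `a ∈ P^𝔪`, `a = b/c`
  rw [primeClass_eq, QuotientGroup.eq_one_iff, Subgroup.mem_subgroupOf, mem_ray_iff] at h2
  obtain ⟨a, ha, hav⟩ := h2
  obtain ⟨b, c, hb, hc, hcop, hbc, hpos, hab⟩ := exists_eq_div_of_mem_rayElements h𝔪 ha
  refine ⟨b, c, hb, hc, hcop, hbc, hpos, ?_⟩
  rw [Ideal.mul_top]
  -- `(c) 𝔭_v = (b)` as fractional ideals
  have hbK : (b : K) ≠ 0 := by exact_mod_cast hb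
  have hcK : (c : K) ≠ 0 := by exact_mod_cast hc
  have haeq : a = Units.mk0 (b : K) hbK / Units.mk0 (c : K) hcK := Units.ext (by simp [hab])
  have hv' : ((toPrincipalIdeal (𝓞 K) K a : (FractionalIdeal (𝓞 K)⁰ K)ˣ) : FractionalIdeal (𝓞 K)⁰ K) =
      (((unitOfPrime 𝔪 h𝔪 v : idealsPrimeTo 𝔪) : (FractionalIdeal (𝓞 K)⁰ K)ˣ) :
        FractionalIdeal (𝓞 K)⁰ K) := by rw [hav]
  rw [coe_unitOfPrime_of_not_le h𝔪 hv, haeq, map_div, toPrincipalIdeal_unitsMk0_coe hb,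
    toPrincipalIdeal_unitsMk0_coe hc, Units.val_div_eq_div_val, Units.val_mk0, Units.val_mk0,
    div_eq_iff (coeIdeal_ne_zero_of_ne_bot (by simpa [Ideal.span_singleton_eq_bot] using hc)),
    ← FractionalIdeal.coeIdeal_mul, FractionalIdeal.coeIdeal_inj] at hv'
  rw [mul_comm, ← hv']

/-- **The ray class field data for a field without real places** (e.g. imaginary quadratic): every
prime `v ∤ 𝔪` splitting completely in `R` is principal, `𝔭_v = (a)`, with a generator `a ≡ 1 mod 𝔪`
(from `(c) 𝔭_v = (b)`: `a = b/c ∈ 𝓞 K` and `c (a - 1) = b - c ∈ 𝔪` with `c` a unit `mod 𝔪`).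
[cite: NeukirchANT1999, Ch. VI §6 (6.2)–(6.3) and §7 (7.3)] [cite: Cox2013, §8.A Thm. 8.2 and Thm. 8.6] -/
theorem exists_rayClassField_data_principal (h𝔪 : 𝔪 ≠ ⊥) :
    ∃ R : IntermediateField K (AlgebraicClosure K), FiniteDimensional K R ∧ IsGalois K R ∧
      (∀ v : HeightOneSpectrum (𝓞 K), ¬ 𝔪 ≤ v.asIdeal → Algebra.IsUnramifiedIn (𝓞 R) v.asIdeal) ∧
      ∀ v : HeightOneSpectrum (𝓞 K), ¬ 𝔪 ≤ v.asIdeal → v ∈ splitPrimes K R →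
        ∃ a : 𝓞 K, v.asIdeal = Ideal.span {a} ∧ a - 1 ∈ 𝔪 := by
  obtain ⟨R, hfd, hgal, hunr, hspl⟩ := exists_rayClassField_data (K := K) h𝔪
  refine ⟨R, hfd, hgal, hunr, fun v hv hsplit => ?_⟩
  obtain ⟨b, c, hb, hc, hcop, hbc, -, heq⟩ := hspl v hv hsplit
  rw [Ideal.mul_top] at heq
  -- `b ∈ (c)·𝔭 ⊆ (c)`: `b = c a`
  have hbmem : b ∈ Ideal.span {c} * v.asIdeal := by rw [heq]; exact Ideal.mem_span_singleton_self b
  have hbc' : b ∈ Ideal.span {c} := Ideal.mul_le_right hbmem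
  obtain ⟨a, rfl⟩ := Ideal.mem_span_singleton'.mp hbc'
  -- then `(c) 𝔭 = (c) (a)`, so `𝔭 = (a)`
  have hc' : Ideal.span {c} ≠ ⊥ := by simpa [Ideal.span_singleton_eq_bot] using hc
  have hva : v.asIdeal = Ideal.span {a} := by
    have : Ideal.span {c} * v.asIdeal = Ideal.span {c} * Ideal.span {a} := by
      rw [heq, Ideal.span_singleton_mul_span_singleton, mul_comm]
    exact mul_left_cancel₀ hc' this
  refine ⟨a, hva, ?_⟩
  -- `c (a - 1) = a c - c = b - c ∈ 𝔪` and `c` is a unit mod `𝔪`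
  have hmem : c * (a - 1) ∈ 𝔪 := by
    have : c * (a - 1) = a * c - c := by ring
    rw [this]; exact hbc
  obtain ⟨x, hx, y, hy, hxy⟩ := Ideal.isCoprime_iff_exists.mp hcop
  obtain ⟨r, rfl⟩ := Ideal.mem_span_singleton'.mp hx
  have e : a - 1 = r * (c * (a - 1)) + y * (a - 1) := by linear_combination -(a - 1) * hxy
  rw [e]
  exact 𝔪.add_mem (𝔪.mul_mem_left r hmem) (𝔪.mul_mem_right _ hy)

end RayClassField


end Literature.NumberTheory.NumberFields

end
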